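import Mathlib
import HarnessLib
import Literature.Computability.Complexity.CNF
import Literature.Computability.Complexity.PNPWave0
import Summits.PneNP.PneNP.Theorems.OverlapGapAlgebraSearchHardWindowLocalRungPatterns
import Summits.PneNP.PneNP.Theorems.OverlapGapAlgebraSearchHardWindowLocalRung
import Summits.PneNP.PneNP.Theorems.OverlapGapAlgebraSearchHardWindowLocalRungExpSigns
import Summits.PneNP.PneNP.Theorems.OverlapGapAlgebraSearchHardWindowLocalRungHighDegree

/-!
# PneNP / OverlapGapAlgebra — `SearchHardWindow`: local rules with `o(n)` bits of advice fail

Support for crux `stmt-PneNP-2460` (`Summit.PneNP.PneNP.Theses.OverlapGapAlgebra.SearchHardWindow`),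
seventh file of the OCCURRENCE-LOCAL RUNG (prefix `shwL_`). The hardness conjunct of the crux is
proved UNCONDITIONALLY, for every `k` and every `α > 1` (hence at the window density
`α_k = 5·2^k log k/k` for every `k ≥ 2`), for the class of solvers whose output bit `x_v` is an
arbitrary function of (the variable pattern, an ADVICE value `h(Φ)` taking at most `N n` values
with `log N n = o(n)`, the polarities of `v`'s own occurrences). This class contains the
occurrence-local rules of `…LocalRung` (`N = 1`: majority / threshold votes, matched-formula
decoders), the solvers of the polarity rung that retain `o(n)` bits of the polarities, and every
combination "local rule steered by sublinear global statistics of the instance" (densities of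
positive occurrences, any `o(n)`-bit sketch of the formula, the output of any `o(n)`-bit
preprocessing).

* `shwL_ratio_le_advice` — finite form: for `D`, `q`, `r, hh ≥ 1` with
  `(kD + 1) q + n + r + hh ≤ m`, the solved fraction of `F_k(n, m)` is at most
  `N (1 - 4^{-k})^q + m k²/(r n) + m k · C(mk - 1, D)/(hh · n^D)`;
* `shwL_ratio_eventually_le_advice` — asymptotic form: success probability `→ 0` whenever
  `α > 1` and `N n ≤ e^{cn}` eventually for every `c > 0` (degree cut-off `D = D(ε)` from
  `(αk)^D/D! → 0`, `q ≍ n/(kD+1)`, main term `N n (1 - 4^{-k})^q ≤ e^{cn - 4^{-k} q}`);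
* `shwL_hardnessConjunct_of_localAdvice`, `shwL_hardnessConjunct_window_of_localAdvice` — the
  conjunct of the crux verbatim (`f : List Bool → List Bool`, `encodingCNF`, `List.getD`), for
  `α > 1` resp. at `α_k` for `k ≥ 2`.

No definitions; axioms `propext`, `Classical.choice`, `Quot.sound`.
-/

set_option linter.dupNamespace false -- `Summit.PneNP.PneNP.…`: summit = sub-problem (D-0017)

namespace Summit.PneNP.PneNP.Theorems

open Finset

section AdviceAssembly

variable {m k n : ℕ}

/-- **Occurrence-local rules with global advice, all variable patterns (finite form).** Let the
solver `A` of `F_k(n, m)` be occurrence-local GIVEN an advice `h Φ` with at most `N` values: on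
instances with the same variable pattern and the same advice value, output bit `v` depends only
on the polarities of the occurrences of `v`. Then for all `D`, `q`, `r ≥ 1`, `hh ≥ 1` with
`(kD + 1) q + n + r + hh ≤ m`, the solved fraction is at most
`N (1 - 4^{-k})^q + m k²/(r n) + m k · C(mk - 1, D)/(hh · n^D)`. -/
theorem shwL_ratio_le_advice (A : (Fin m → Fin k → Fin n × Bool) → (Fin n → Bool)) (N : ℕ)
    (h : (Fin m → Fin k → Fin n × Bool) → Fin N)
    (hA : ∀ Φ Ψ : Fin m → Fin k → Fin n × Bool, (∀ i j, (Φ i j).1 = (Ψ i j).1) → h Φ = h Ψ →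
      ∀ v : Fin n, (∀ i j, (Φ i j).1 = v → (Φ i j).2 = (Ψ i j).2) → A Φ v = A Ψ v)
    (D q r hh : ℕ) (hr : 0 < r) (hhh : 0 < hh) (hn : 0 < n)
    (hm : (k * D + 1) * q + n + r + hh ≤ m) :
    ((univ.filter fun Φ : Fin m → Fin k → Fin n × Bool =>
        ∀ i, ∃ j, A Φ (Φ i j).1 = (Φ i j).2).card : ℝ)
        / Fintype.card (Fin m → Fin k → Fin n × Bool)
      ≤ N * (1 - (1 / 4 : ℝ) ^ k) ^ q + ((m * k ^ 2 : ℕ) : ℝ) / ((r * n : ℕ) : ℝ)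
        + ((m * k * (m * k - 1).choose D : ℕ) : ℝ) / ((hh * n ^ D : ℕ) : ℝ) := by
  obtain ⟨NV, hNV⟩ : ∃ NV, NV = Fintype.card (Fin m × Fin k → Fin n) := ⟨_, rfl⟩
  obtain ⟨NS, hNS⟩ : ∃ NS, NS = Fintype.card (Fin m × Fin k → Bool) := ⟨_, rfl⟩
  obtain ⟨sol, hsol⟩ : ∃ sol : (Fin m × Fin k → Fin n) → ℕ, sol = fun V =>
      (univ.filter fun S : Fin m × Fin k → Bool =>
        ∀ i, ∃ j, A (fun i j => (V (i, j), S (i, j))) (V (i, j)) = S (i, j)).card := ⟨_, rfl⟩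
  obtain ⟨badR, hbadR⟩ : ∃ badR : Finset (Fin m × Fin k → Fin n), badR = univ.filter fun V =>
      r ≤ (univ.filter fun i : Fin m => ¬ Function.Injective fun j : Fin k => V (i, j)).card :=
    ⟨_, rfl⟩
  obtain ⟨badH, hbadH⟩ : ∃ badH : Finset (Fin m × Fin k → Fin n), badH = univ.filter fun V =>
      hh ≤ (univ.filter fun i : Fin m => ∃ j : Fin k,
        D < (univ.filter fun a : Fin m × Fin k => V a = V (i, j)).card).card := ⟨_, rfl⟩
  have hNVpos : 0 < NV := by
    rw [hNV]; haveI : Nonempty (Fin n) := ⟨⟨0, hn⟩⟩; exact Fintype.card_pos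
  have hNSpos : 0 < NS := by rw [hNS]; exact Fintype.card_pos
  set p : ℝ := (1 - (1 / 4 : ℝ) ^ k) with hp
  have hp0 : 0 ≤ p := sub_nonneg.2 (pow_le_one₀ (by norm_num) (by norm_num))
  -- per-pattern bound on the good patterns
  have hgood : ∀ V : Fin m × Fin k → Fin n, V ∉ badR → V ∉ badH →
      (sol V : ℝ) ≤ N * p ^ q * NS := by
    intro V hVR hVH
    have hrep : (univ.filter fun i : Fin m =>
        ¬ Function.Injective fun j : Fin k => V (i, j)).card < r := by
      by_contra hv
      exact hVR (by rw [hbadR, mem_filter]; exact ⟨mem_univ _, not_lt.1 hv⟩)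
    have hhigh : (univ.filter fun i : Fin m => ∃ j : Fin k,
        D < (univ.filter fun a : Fin m × Fin k => V a = V (i, j)).card).card < hh := by
      by_contra hv
      exact hVH (by rw [hbadH, mem_filter]; exact ⟨mem_univ _, not_lt.1 hv⟩)
    have hsplit := Finset.card_filter_add_card_filter_not (s := (univ : Finset (Fin m)))
      (fun i : Fin m => Function.Injective fun j : Fin k => V (i, j))
    rw [card_univ, Fintype.card_fin] at hsplit
    have hq : (k * D + 1) * q ≤ (univ.filter fun i : Fin m =>
        Function.Injective fun j : Fin k => V (i, j)).card - n
          - (univ.filter fun i : Fin m => ∃ j : Fin k,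
              D < (univ.filter fun a : Fin m × Fin k => V a = V (i, j)).card).card := by omega
    have hfix := shwL_card_solved_signs_le_advice V (fun S => A fun i j => (V (i, j), S (i, j))) N
      (fun S => h fun i j => (V (i, j), S (i, j)))
      (fun v S S' hh' hSS' => hA (fun i j => (V (i, j), S (i, j))) (fun i j => (V (i, j), S' (i, j)))
        (fun _ _ => rfl) hh' v fun i j hij => hSS' (i, j) hij) D n
      (fun W hW _ => calc W.card ≤ (univ : Finset (Fin n)).card :=
            card_le_card_of_injOn V (fun a _ => mem_coe.2 (mem_univ (V a))) hW
        _ = n := by rw [card_univ, Fintype.card_fin]) q hq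
    rw [hsol, hNS]
    exact hfix
  have htriv : ∀ V : Fin m × Fin k → Fin n, (sol V : ℝ) ≤ NS := by
    intro V; rw [hsol, hNS]; exact_mod_cast card_le_univ _
  -- sum over patterns
  have hsum : ∑ V : Fin m × Fin k → Fin n, (sol V : ℝ)
      ≤ NV * (N * p ^ q * NS) + NS * (badR.card + badH.card) := by
    have hpt : ∀ V : Fin m × Fin k → Fin n, (sol V : ℝ) ≤ N * p ^ q * NS
        + NS * ((if V ∈ badR then 1 else 0) + (if V ∈ badH then 1 else 0)) := by
      intro V
      have hmain0 : (0 : ℝ) ≤ N * p ^ q * NS := by positivity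
      by_cases hVR : V ∈ badR
      · simp only [hVR, if_true]
        have := htriv V
        nlinarith [this, hmain0, show (0 : ℝ) ≤ (if V ∈ badH then 1 else 0) by positivity,
          show (0 : ℝ) ≤ (NS : ℝ) from Nat.cast_nonneg _]
      · by_cases hVH : V ∈ badH
        · simp only [hVR, hVH, if_true, if_false, zero_add, mul_one]
          linarith [htriv V]
        · simp only [hVR, hVH, if_false, add_zero, mul_zero]
          exact hgood V hVR hVH
    calc ∑ V : Fin m × Fin k → Fin n, (sol V : ℝ)
        ≤ ∑ V : Fin m × Fin k → Fin n, (N * p ^ q * NS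
            + NS * ((if V ∈ badR then 1 else 0) + (if V ∈ badH then 1 else 0))) :=
          sum_le_sum fun V _ => hpt V
      _ = NV * (N * p ^ q * NS) + NS * (badR.card + badH.card) := by
          rw [sum_add_distrib, sum_const, card_univ, ← hNV, nsmul_eq_mul, ← mul_sum,
            sum_add_distrib, sum_boole, sum_boole]
          congr 2
          simp
  -- the two Markov bounds
  have hR : badR.card * r * n ≤ m * k ^ 2 * NV := by
    rw [hbadR, hNV]; exact shwL_card_manyRepeats_mul_le r
  have hH : badH.card * hh * n ^ D ≤ m * k * (m * k - 1).choose D * NV := by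
    rw [hbadH, hNV]; exact shwL_card_manyHighClauses_mul_le D hh
  -- to real numbers
  rw [shwL_card_solved_eq_sum, shwL_card_inst_eq, ← hNV, ← hNS]
  have hsol' : (∑ V : Fin m × Fin k → Fin n, (univ.filter fun S : Fin m × Fin k → Bool =>
      ∀ i, ∃ j, A (fun i j => (V (i, j), S (i, j))) (V (i, j)) = S (i, j)).card)
        = ∑ V : Fin m × Fin k → Fin n, sol V := by rw [hsol]
  rw [hsol']
  have hNV' : (0 : ℝ) < NV := by exact_mod_cast hNVpos
  have hNS' : (0 : ℝ) < NS := by exact_mod_cast hNSpos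
  have hn' : (0 : ℝ) < n := by exact_mod_cast hn
  have hr' : (0 : ℝ) < r := by exact_mod_cast hr
  have hhh' : (0 : ℝ) < hh := by exact_mod_cast hhh
  have hRR : (badR.card : ℝ) * r * n ≤ (m : ℝ) * k ^ 2 * NV := by exact_mod_cast hR
  have hHR : (badH.card : ℝ) * hh * n ^ D ≤ (m : ℝ) * k * ((m * k - 1).choose D : ℕ) * NV := by
    exact_mod_cast hH
  have h1 : (∑ V : Fin m × Fin k → Fin n, (sol V : ℝ)) / (NV * NS)
      ≤ N * p ^ q + (badR.card + badH.card) / NV := by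
    rw [div_le_iff₀ (by positivity)]
    have : (↑N * p ^ q + (↑badR.card + ↑badH.card) / ↑NV) * (↑NV * ↑NS)
        = NV * (N * p ^ q * NS) + NS * (badR.card + badH.card) := by
      field_simp
    rw [this]; exact hsum
  have h2 : ((badR.card : ℝ) + badH.card) / NV
      ≤ ((m * k ^ 2 : ℕ) : ℝ) / ((r * n : ℕ) : ℝ)
        + ((m * k * (m * k - 1).choose D : ℕ) : ℝ) / ((hh * n ^ D : ℕ) : ℝ) := by
    rw [add_div]
    push_cast
    refine add_le_add ?_ ?_
    · rw [div_le_div_iff₀ hNV' (by positivity)]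
      nlinarith [hRR]
    · rw [div_le_div_iff₀ hNV' (by positivity)]
      nlinarith [hHR]
  push_cast [Nat.cast_sum] at h1 h2 ⊢
  linarith [h1, h2]

end AdviceAssembly

section AdviceAsymptotic

open Filter
open Literature.Computability.Complexity

/-- **Occurrence-local rules with `o(n)` bits of global advice fail (every `k`, every `α > 1`).**
Let `A n m` solve `F_k(n, ⌊αn⌋)` in the following shape: there is an advice `h Φ` with at most
`N n` values, `log N n = o(n)` (hypothesis: `N n ≤ e^{cn}` eventually, for every `c > 0`), such that
on instances with the same variable pattern and the same advice, output bit `v` is a function of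
the polarities of `v`'s own occurrences. Then the success probability tends to `0`. The class
contains every occurrence-local rule (`N = 1`), every solver retaining `o(n)` bits of the polarities
(cf. the polarity rung, where the rules ignore even their own occurrences), and all combinations
"local rule + sublinear global statistics of the instance". Proof: `shwL_ratio_le_advice` with a
degree cut-off `D = D(ε)` (`(αk)^D/D! → 0`), `q ≍ n/(kD+1)`, `r = hh ≍ (α-1)n/4`; the main term is
`N n · (1 - 4^{-k})^{q} ≤ e^{cn - 4^{-k} q} → 0`. -/
theorem shwL_ratio_eventually_le_advice (k : ℕ) (α : ℝ) (hα : 1 < α) (N : ℕ → ℕ)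
    (hN : ∀ c : ℝ, 0 < c → ∀ᶠ n : ℕ in atTop, (N n : ℝ) ≤ Real.exp (c * n))
    (A : (n m : ℕ) → (Fin m → Fin k → Fin n × Bool) → (Fin n → Bool))
    (hA : ∀ᶠ n : ℕ in atTop, ∀ m : ℕ, m = ⌊α * n⌋₊ →
      ∃ h : (Fin m → Fin k → Fin n × Bool) → Fin (N n),
        ∀ Φ Ψ : Fin m → Fin k → Fin n × Bool, (∀ i j, (Φ i j).1 = (Ψ i j).1) → h Φ = h Ψ →
          ∀ v : Fin n, (∀ i j, (Φ i j).1 = v → (Φ i j).2 = (Ψ i j).2) → A n m Φ v = A n m Ψ v)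
    (ε : ℝ) (hε : 0 < ε) :
    ∀ᶠ n : ℕ in atTop, ∀ m : ℕ, m = ⌊α * n⌋₊ →
      (((univ : Finset (Fin m → Fin k → Fin n × Bool)).filter fun Φ =>
          ∀ i, ∃ j, A n m Φ (Φ i j).1 = (Φ i j).2).card : ℝ)
        / Fintype.card (Fin m → Fin k → Fin n × Bool) ≤ ε := by
  have hα1 : 0 < α - 1 := by linarith
  have hαpos : 0 < α := by linarith
  -- the degree cut-off
  set η : ℝ := ε * (α - 1) / (12 * (α * k + 1)) with hη
  have hηpos : 0 < η := by positivity
  obtain ⟨D, hD⟩ : ∃ D : ℕ, (α * k) ^ D / (D.factorial : ℝ) ≤ η :=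
    ((FloorSemiring.tendsto_pow_div_factorial_atTop (α * k)).eventually (ge_mem_nhds hηpos)).exists
  -- constants of the main term
  set p : ℝ := 1 - (1 / 4 : ℝ) ^ k with hp
  have hp0 : 0 ≤ p := sub_nonneg.2 (pow_le_one₀ (by norm_num) (by norm_num))
  have hpexp : p ≤ Real.exp (-(1 / 4 : ℝ) ^ k) := Real.one_sub_le_exp_neg _
  have h4k : (0 : ℝ) < (1 / 4 : ℝ) ^ k := by positivity
  set c₁ : ℝ := (α - 1) / (2 * (k * D + 1)) with hc₁
  have hkD : (0 : ℝ) < k * D + 1 := by positivity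
  have hc₁pos : 0 < c₁ := by positivity
  set c : ℝ := (1 / 4 : ℝ) ^ k * c₁ / 2 with hc
  have hcpos : 0 < c := by positivity
  -- eventualities
  have hlim1 : Tendsto (fun n : ℕ => Real.exp (4 * (1 / 4 : ℝ) ^ k) * Real.exp (-(c * n)))
      atTop (nhds 0) :=
    mul_zero (Real.exp (4 * (1 / 4 : ℝ) ^ k)) ▸ Tendsto.const_mul _ (Real.tendsto_exp_atBot.comp
      (tendsto_neg_atTop_atBot.comp (Tendsto.const_mul_atTop hcpos tendsto_natCast_atTop_atTop)))
  have h1 : ∀ᶠ n : ℕ in atTop, Real.exp (4 * (1 / 4 : ℝ) ^ k) * Real.exp (-(c * n)) ≤ ε / 3 :=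
    hlim1.eventually (ge_mem_nhds (by positivity))
  have h2 : ∀ᶠ n : ℕ in atTop, 4 * α * k ^ 2 / (α - 1) / (n : ℝ) ≤ ε / 3 :=
    (tendsto_const_div_atTop_nhds_zero_nat _).eventually (ge_mem_nhds (by positivity))
  have h0 : ∀ᶠ n : ℕ in atTop, 8 / (α - 1) ≤ (n : ℝ) :=
    tendsto_natCast_atTop_atTop.eventually_ge_atTop _
  filter_upwards [hA, hN c hcpos, h1, h2, h0, eventually_ge_atTop 1] with n hAn hNn h1n h2n h0n hn1
  intro m hm
  obtain ⟨h, hh⟩ := hAn m hm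
  -- parameters
  set r : ℕ := ⌊(α - 1) / 4 * n⌋₊ + 1 with hr
  set q : ℕ := ⌊((α - 1) / 2 * n - 3) / (k * D + 1)⌋₊ with hq
  have hnpos : (0 : ℝ) < n := by exact_mod_cast hn1
  have hn8 : 8 ≤ (α - 1) * n := by
    have := (div_le_iff₀ hα1).1 h0n; linarith
  have hm_le : (m : ℝ) ≤ α * n := by rw [hm]; exact Nat.floor_le (by positivity)
  have hm_gt : α * n - 1 < (m : ℝ) := by
    rw [hm]; linarith [Nat.lt_floor_add_one (α * n)]
  have hr_le : (r : ℝ) ≤ (α - 1) / 4 * n + 1 := by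
    rw [hr]; push_cast; linarith [Nat.floor_le (show 0 ≤ (α - 1) / 4 * n by positivity)]
  have hr_ge : (α - 1) / 4 * n ≤ (r : ℝ) := by
    rw [hr]; push_cast; linarith [Nat.lt_floor_add_one ((α - 1) / 4 * n)]
  have hx0 : 0 ≤ ((α - 1) / 2 * n - 3) / (k * D + 1) := div_nonneg (by linarith) hkD.le
  have hq_le : (k * D + 1 : ℝ) * q ≤ (α - 1) / 2 * n - 3 := by
    have := Nat.floor_le hx0
    rw [← hq] at this
    rw [← le_div_iff₀' hkD]; exact this
  have hq_ge : c₁ * n - 4 ≤ (q : ℝ) := by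
    have h1' : ((α - 1) / 2 * n - 3) / (k * D + 1) - 1 ≤ (q : ℝ) := by
      rw [hq]; linarith [Nat.lt_floor_add_one (((α - 1) / 2 * n - 3) / (k * D + 1))]
    have h3 : (3 : ℝ) / (k * D + 1) ≤ 3 := by
      rw [div_le_iff₀ hkD]; nlinarith
    have : ((α - 1) / 2 * n - 3) / (k * D + 1) = c₁ * n - 3 / (k * D + 1) := by
      rw [hc₁]; field_simp
    linarith
  -- the size condition of the finite form
  have hmcond : (k * D + 1) * q + n + r + r ≤ m := by
    have : (((k * D + 1) * q + n + r + r : ℕ) : ℝ) < m := by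
      push_cast; linarith
    exact (Nat.cast_lt.1 this).le
  have hfin := shwL_ratio_le_advice (A n m) (N n) h hh D q r r (Nat.succ_pos _) (Nat.succ_pos _)
    hn1 hmcond
  -- term 1: the main term
  have t1 : (N n : ℝ) * (1 - (1 / 4 : ℝ) ^ k) ^ q ≤ ε / 3 := by
    rw [← hp]
    have hpq : p ^ q ≤ Real.exp (-((1 / 4 : ℝ) ^ k * (c₁ * n - 4))) := by
      calc p ^ q ≤ (Real.exp (-(1 / 4 : ℝ) ^ k)) ^ q := pow_le_pow_left₀ hp0 hpexp q
        _ = Real.exp (-((1 / 4 : ℝ) ^ k * q)) := by rw [← Real.exp_nat_mul]; ring_nf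
        _ ≤ Real.exp (-((1 / 4 : ℝ) ^ k * (c₁ * n - 4))) :=
            Real.exp_le_exp.2 (neg_le_neg (mul_le_mul_of_nonneg_left hq_ge h4k.le))
    calc (N n : ℝ) * p ^ q
        ≤ Real.exp (c * n) * Real.exp (-((1 / 4 : ℝ) ^ k * (c₁ * n - 4))) :=
          mul_le_mul hNn hpq (pow_nonneg hp0 _) (Real.exp_pos _).le
      _ = Real.exp (4 * (1 / 4 : ℝ) ^ k) * Real.exp (-(c * n)) := by
          rw [← Real.exp_add, ← Real.exp_add, hc]; ring_nf
      _ ≤ ε / 3 := h1n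
  -- term 2: repeating clauses
  have t2 : ((m * k ^ 2 : ℕ) : ℝ) / ((r * n : ℕ) : ℝ) ≤ ε / 3 := by
    have hC : 4 * α * k ^ 2 / (α - 1) ≤ ε / 3 * n := (div_le_iff₀ hnpos).1 h2n
    have hrpos' : (0 : ℝ) < r := by rw [hr]; push_cast; positivity
    push_cast
    rw [div_le_iff₀ (by positivity)]
    have hk0 : (0 : ℝ) ≤ (k : ℝ) ^ 2 := by positivity
    calc (m : ℝ) * k ^ 2 ≤ α * n * k ^ 2 := mul_le_mul_of_nonneg_right hm_le hk0
      _ = 4 * α * k ^ 2 / (α - 1) * ((α - 1) / 4 * n) := by field_simp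
      _ ≤ ε / 3 * n * ((α - 1) / 4 * n) := mul_le_mul_of_nonneg_right hC (by positivity)
      _ ≤ ε / 3 * n * r := mul_le_mul_of_nonneg_left hr_ge (by positivity)
      _ = ε / 3 * (r * n) := by ring
  -- term 3: clauses touching a high-degree variable
  have t3 : ((m * k * (m * k - 1).choose D : ℕ) : ℝ) / ((r * n ^ D : ℕ) : ℝ) ≤ ε / 3 := by
    have hrpos' : (0 : ℝ) < r := by rw [hr]; push_cast; positivity
    have hk0 : (0 : ℝ) ≤ k := Nat.cast_nonneg _
    have hchoose : (((m * k - 1).choose D : ℕ) : ℝ) ≤ (α * k) ^ D * (n : ℝ) ^ D / D.factorial := by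
      have hmk : ((m * k - 1 : ℕ) : ℝ) ≤ α * n * k := by
        calc ((m * k - 1 : ℕ) : ℝ) ≤ ((m * k : ℕ) : ℝ) := by exact_mod_cast Nat.sub_le _ _
          _ = (m : ℝ) * k := by push_cast; ring
          _ ≤ α * n * k := mul_le_mul_of_nonneg_right hm_le hk0
      calc (((m * k - 1).choose D : ℕ) : ℝ) ≤ ((m * k - 1 : ℕ) : ℝ) ^ D / D.factorial := by
            have := Nat.choose_le_pow_div (α := ℝ) D (m * k - 1)
            exact_mod_cast this
        _ ≤ (α * n * k) ^ D / D.factorial := by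
            gcongr
        _ = (α * k) ^ D * (n : ℝ) ^ D / D.factorial := by ring
    have hDfac : (0 : ℝ) < D.factorial := by exact_mod_cast Nat.factorial_pos D
    have hmain : (m : ℝ) * k * (((m * k - 1).choose D : ℕ) : ℝ)
        ≤ α * k * η * (n : ℝ) ^ (D + 1) := by
      calc (m : ℝ) * k * (((m * k - 1).choose D : ℕ) : ℝ)
          ≤ α * n * k * ((α * k) ^ D * (n : ℝ) ^ D / D.factorial) :=
            mul_le_mul (mul_le_mul_of_nonneg_right hm_le hk0) hchoose (Nat.cast_nonneg _)
              (by positivity)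
        _ = α * k * ((α * k) ^ D / D.factorial) * (n : ℝ) ^ (D + 1) := by ring
        _ ≤ α * k * η * (n : ℝ) ^ (D + 1) := by
            refine mul_le_mul_of_nonneg_right (mul_le_mul_of_nonneg_left hD (by positivity)) ?_
            positivity
    have hηb : α * k * η ≤ ε * (α - 1) / 12 := by
      have h1 : α * k * η = α * k / (α * k + 1) * (ε * (α - 1) / 12) := by
        rw [hη]; field_simp
      rw [h1]
      exact mul_le_of_le_one_left (by positivity)
        ((div_le_one (by positivity)).2 (by linarith))
    push_cast
    rw [div_le_iff₀ (by positivity)]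
    calc (m : ℝ) * k * (((m * k - 1).choose D : ℕ) : ℝ)
        ≤ α * k * η * (n : ℝ) ^ (D + 1) := hmain
      _ ≤ ε * (α - 1) / 12 * (n : ℝ) ^ (D + 1) := mul_le_mul_of_nonneg_right hηb (by positivity)
      _ = ε / 3 * ((α - 1) / 4 * n) * (n : ℝ) ^ D := by ring
      _ ≤ ε / 3 * r * (n : ℝ) ^ D := by
          refine mul_le_mul_of_nonneg_right (mul_le_mul_of_nonneg_left hr_ge (by positivity)) ?_
          positivity
      _ = ε / 3 * (r * (n : ℝ) ^ D) := by ring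
  linarith [hfin, t1, t2, t3]

end AdviceAsymptotic

section AdviceCorollaries

open Filter
open Literature.Computability.Complexity

/-- **Local rules with `o(n)` advice bits: the crux's hardness conjunct (verbatim shape).** For ANY
`f : List Bool → List Bool` (no complexity hypothesis) and any `α > 1`: if, eventually in `n`,
there is an advice `h` on the instances of `F_k(n, ⌊αn⌋)` with at most `N n` values,
`N n ≤ e^{cn}` eventually for every `c > 0`, such that the decoded bit `v` of `f` is a function of
(variable pattern, advice value, polarities of the occurrences of `v`), then `f` satisfies the
hardness conjunct of `SearchHardWindow` at `(k, α)`. -/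
theorem shwL_hardnessConjunct_of_localAdvice (k : ℕ) (α : ℝ) (hα : 1 < α)
    (f : List Bool → List Bool) (N : ℕ → ℕ)
    (hN : ∀ c : ℝ, 0 < c → ∀ᶠ n : ℕ in atTop, (N n : ℝ) ≤ Real.exp (c * n))
    (hf : ∀ᶠ n : ℕ in atTop, ∀ m : ℕ, m = ⌊α * n⌋₊ →
      ∃ h : (Fin m → Fin k → Fin n × Bool) → Fin (N n),
        ∀ Φ Ψ : Fin m → Fin k → Fin n × Bool, (∀ i j, (Φ i j).1 = (Ψ i j).1) → h Φ = h Ψ →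
          ∀ v : Fin n, (∀ i j, (Φ i j).1 = v → (Φ i j).2 = (Ψ i j).2) →
            (f (encodingCNF.encode (List.ofFn fun a => List.ofFn fun b =>
                (((Φ a b).1 : ℕ), (Φ a b).2)))).getD v false
              = (f (encodingCNF.encode (List.ofFn fun a => List.ofFn fun b =>
                (((Ψ a b).1 : ℕ), (Ψ a b).2)))).getD v false) :
    ∀ ε : ℝ, 0 < ε → ∀ᶠ n : ℕ in Filter.atTop, ∀ m : ℕ, m = ⌊α * n⌋₊ →
      ((Finset.univ.filter fun Φ : Fin m → Fin k → Fin n × Bool => ∀ i, ∃ j,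
          (f (Literature.Computability.Complexity.encodingCNF.encode (List.ofFn fun a =>
            List.ofFn fun b => (((Φ a b).1 : ℕ), (Φ a b).2)))).getD (Φ i j).1 false =
              (Φ i j).2).card : ℝ) / Fintype.card (Fin m → Fin k → Fin n × Bool) ≤ ε := by
  intro ε hε
  exact shwL_ratio_eventually_le_advice k α hα N hN
    (fun n m Φ v => (f (encodingCNF.encode (List.ofFn fun a => List.ofFn fun b =>
      (((Φ a b).1 : ℕ), (Φ a b).2)))).getD v false) hf ε hε

/-- **Local rules with `o(n)` advice bits at the window.** The same at the window density
`α_k = 5·2^k log k/k` of the crux, for every `k ≥ 2` — unconditionally. -/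
theorem shwL_hardnessConjunct_window_of_localAdvice (k : ℕ) (hk : 2 ≤ k)
    (f : List Bool → List Bool) (N : ℕ → ℕ)
    (hN : ∀ c : ℝ, 0 < c → ∀ᶠ n : ℕ in atTop, (N n : ℝ) ≤ Real.exp (c * n))
    (hf : ∀ᶠ n : ℕ in atTop, ∀ m : ℕ, m = ⌊5 * 2 ^ k * Real.log k / k * n⌋₊ →
      ∃ h : (Fin m → Fin k → Fin n × Bool) → Fin (N n),
        ∀ Φ Ψ : Fin m → Fin k → Fin n × Bool, (∀ i j, (Φ i j).1 = (Ψ i j).1) → h Φ = h Ψ →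
          ∀ v : Fin n, (∀ i j, (Φ i j).1 = v → (Φ i j).2 = (Ψ i j).2) →
            (f (encodingCNF.encode (List.ofFn fun a => List.ofFn fun b =>
                (((Φ a b).1 : ℕ), (Φ a b).2)))).getD v false
              = (f (encodingCNF.encode (List.ofFn fun a => List.ofFn fun b =>
                (((Ψ a b).1 : ℕ), (Ψ a b).2)))).getD v false) :
    ∀ ε : ℝ, 0 < ε → ∀ᶠ n : ℕ in Filter.atTop, ∀ m : ℕ, m = ⌊5 * 2 ^ k * Real.log k / k * n⌋₊ →
      ((Finset.univ.filter fun Φ : Fin m → Fin k → Fin n × Bool => ∀ i, ∃ j,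
          (f (Literature.Computability.Complexity.encodingCNF.encode (List.ofFn fun a =>
            List.ofFn fun b => (((Φ a b).1 : ℕ), (Φ a b).2)))).getD (Φ i j).1 false =
              (Φ i j).2).card : ℝ) / Fintype.card (Fin m → Fin k → Fin n × Bool) ≤ ε :=
  shwL_hardnessConjunct_of_localAdvice k _ (shwL_one_lt_windowDensity hk) f N hN hf

end AdviceCorollaries

end Summit.PneNP.PneNP.Theorems
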